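import Literature.MathematicalPhysics.QuantumLattice.TorusWilsonFlowExistence
import HarnessLib

/-!
# Continuity of the torus Wilson-flowed action density in the configuration

Topic `Literature/MathematicalPhysics/QuantumLattice` (gauge-group level of
`TorusWilsonFlowExistence.lean`, debt listed under "Deliberately NOT here" in
`BoundedWilsonFlowLift.lean`: "continuity/measurability of `U ↦ flowedEnergy ρ t x U`").
For a continuous unitary matrix representation `ρ : G →* M_N(ℂ)` (any topological group `G`; in
the tree's uses `ρ = r.ρ` of a `LatticeRep`) and a finite lattice (site type `Fin d → R`, `R`
finite — the discrete torus `R = ZMod S` of `GaugeConfig d S G`):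

* `continuous_energyDensity` — the plaquette action density `W ↦ E(W)(x)` (3.1) of a matrix link
  field is continuous (a polynomial in finitely many links);
* `continuous_wilsonFlowMatrix` — the flowed link matrices `U ↦ V_t(ρ ∘ U)` are continuous in the
  configuration: `U ↦ ρ ∘ U` is continuous with unitary values, and the flow `matrixWilsonFlow` is
  continuous on unitary fields (`continuousOn_matrixWilsonFlow`, Lipschitz dependence on the data);
* `continuous_flowedEnergy` — Lüscher's flowed density `U ↦ E_t(x)(U) = flowedEnergy ρ t x U` is
  continuous on `GaugeConfig d S G`, at every real flow time `t`;
* `continuous_boundedFlowedEnergy_torusLift` — the bounded flowed density of the periodic lift,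
  `U ↦ boundedFlowedEnergy ρ t x (torusLift S U)` (`x ∈ ℤ^d`), is continuous on `GaugeConfig d S G`
  (lift lemma `boundedFlowedEnergy_torusLift`). This is the form consumed by the Yang–Mills route
  `ParabolicTrajectory` (flowed observables as honest continuous, hence bounded measurable, random
  variables on the compact torus configuration space).

Everything stated is proved; theorems only.

Deliberately NOT here: joint continuity in `(t, U)`, measurability corollaries (continuity gives
Borel measurability on these second-countable spaces), continuity of the clover density.

## References

* M. Lüscher, *Properties and uses of the Wilson flow in lattice QCD*, JHEP 08 (2010) 071,
  arXiv:1006.4518, eqs. (1.4), (3.1), §1 p. 2. [Luscher2010]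
-/

noncomputable section

open Matrix Set

namespace Literature.MathematicalPhysics.QuantumLattice

/-! ### Gauge-group level: continuity of the flowed link matrices and of the flowed density -/

section GroupLevel

open Literature.Probability.LatticeModels (Torus.proj)
open Literature.MathematicalPhysics.QuantumFieldTheory (GaugeConfig)

variable {d : ℕ} {R : Type*} [AddGroup R] [One R] {N : ℕ} {G : Type*} [Group G]
  [TopologicalSpace G] (ρ : G →* Matrix (Fin N) (Fin N) ℂ)

/-- The action density `W ↦ E(W)(x)` of a link field is continuous (a polynomial in finitely many
link matrices). [folklore] -/
theorem continuous_energyDensity (x : Fin d → R) :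
    Continuous fun W : MatrixLinkField d R N => energyDensity W x := by
  unfold energyDensity plaquetteMatrix
  refine continuous_const.mul (continuous_finsetSum _ fun μ _ =>
    continuous_finsetSum _ fun ν _ => ?_)
  split_ifs
  · refine continuous_const.sub (Complex.continuous_re.comp (Continuous.matrix_trace ?_))
    exact (((continuous_apply _).matrix_mul (continuous_apply _)).matrix_mul
      ((continuous_apply _).matrix_conjTranspose)).matrix_mul
        ((continuous_apply _).matrix_conjTranspose)
  · exact continuous_const

/-- **Continuity of the flowed link matrices in the configuration**: for a continuous unitary
`ρ` on a finite lattice, `U ↦ wilsonFlowMatrix ρ t U` is continuous (composition of the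
continuous `U ↦ ρ ∘ U`, valued in unitary fields, with the flow, continuous there). [folklore] -/
theorem continuous_wilsonFlowMatrix [Finite R] (hρ : Continuous ρ)
    (hu : ∀ g, ρ g ∈ Matrix.unitaryGroup (Fin N) ℂ) (t : ℝ) :
    Continuous fun U : (Fin d → R) × Fin d → G => wilsonFlowMatrix ρ t U := by
  have hH : ∀ A ∈ Set.range ρ, A ∈ Matrix.unitaryGroup (Fin N) ℂ := by
    rintro _ ⟨g, rfl⟩
    exact hu g
  have hc : Continuous fun U : (Fin d → R) × Fin d → G => fun e => ρ (U e) :=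
    continuous_pi fun e => hρ.comp (continuous_apply e)
  exact (continuousOn_matrixWilsonFlow (d := d) (R := R) hH t).comp_continuous hc
    fun U e => hu (U e)

/-- **Continuity of the flowed action density in the configuration**: for a continuous unitary
`ρ` on a finite lattice (e.g. the torus `GaugeConfig d S G`), `U ↦ E_t(x)(U) = flowedEnergy ρ t x U`
is continuous, at every real flow time. [cite: Luscher2010, eqs. (1.4) and (3.1)] -/
theorem continuous_flowedEnergy [Finite R] (hρ : Continuous ρ)
    (hu : ∀ g, ρ g ∈ Matrix.unitaryGroup (Fin N) ℂ) (t : ℝ) (x : Fin d → R) :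
    Continuous fun U : (Fin d → R) × Fin d → G => flowedEnergy ρ t x U :=
  (continuous_energyDensity x).comp (continuous_wilsonFlowMatrix ρ hρ hu t)

/-- **Continuity of the bounded flowed density of the periodic lift**: for a continuous unitary
representation `ρ`, every `S ≥ 1`, every real flow time `t` and every site `x ∈ ℤ^d`,
`U ↦ boundedFlowedEnergy ρ t x (torusLift S U)` is continuous on the torus configuration space
`GaugeConfig d S G` (lift lemma `boundedFlowedEnergy_torusLift` + `continuous_flowedEnergy`). [cite: Luscher2010, §1 p. 2] -/
theorem continuous_boundedFlowedEnergy_torusLift (hρ : Continuous ρ)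
    (hu : ∀ g, ρ g ∈ Matrix.unitaryGroup (Fin N) ℂ) (S : ℕ) [NeZero S] (t : ℝ) (x : Fin d → ℤ) :
    Continuous fun U : GaugeConfig d S G => boundedFlowedEnergy ρ t x (torusLift S U) := by
  simp only [boundedFlowedEnergy_torusLift]
  exact continuous_flowedEnergy ρ hρ hu t (Torus.proj S x)

end GroupLevel

end Literature.MathematicalPhysics.QuantumLattice

end
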